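import Literature.Analysis.FluidPDE.SideSplitting
import HarnessLib

/-!
# The heat kernel and the Gaussian weights of the Oseen kernel along vertical fibres

Analysis/FluidPDE support file (all results proved) for the planar reduction in Step 5 of the
proof of Koch–Nadirashvili–Seregin–Šverák 2009, Theorem 6.2 (arXiv:0709.3599, p. 13; see
`SideSplitting` for the geometry and `OseenKernelSideFibre` for the kernel identity it serves).
Along the fibres `r ↦ (w₀, r, w₁)` of the splitting `sideSplit : ℝ³ ≃ᵐ ℝ × ℝ²`:

* the Gauss–Weierstrass kernel factorises, `G³_s(w₀, r, w₁) = G²_s(w) G¹_s(r)`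
  (`heatKernel_sideSplit_symm`), with the one-dimensional facts `∫ G¹_s = 1`,
  `∫ r² G¹_s(r) dr = 2s`;
* Fubini for half-line Gaussian moments `∫ m(r) ∫_τ^∞ G³_s(w₀, r, w₁)/(c sⁿ) ds dr`
  (`integrable_and_integral_moment_fiber`), whence the fibre integrals of the two Gaussian
  weights `A = oseenWeightA`, `B = oseenWeightB` of the Oseen–Koch–Tataru kernel
  (`KochTataru.lean`; Koch–Tataru 2001, §2 (6)–(8)): `∫ A³ dr = A²`, `∫ B³ dr = B²`, and the
  **Gaussian moment identity** `∫ r² B³(τ, (w₀, r, w₁)) dr = A²(τ, w)`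
  (`integrable_sq_mul_oseenWeightB_fiber`), which is what makes the `e₂ ⊗ e₂`-component of the
  stress drop out of the planar part of the three-dimensional Oseen kernel after integration
  along the fibre.

## Mathlib / tree search

`OseenKernelLineIntegrals` (written for the same step of KNSS's proof) proves, along arbitrary
lines `r ↦ z' + re` (`‖e‖ = 1`, `z' ⊥ e`) of a Euclidean space, the factorisation
`heatKernel_add_smul`, `integral_heatKernel_line`, `integral_sq_mul_heatKernel_line`, the
product-integrability lemmas `integrable_(sq_mul_)heatKernel_div_prod_line`, the fibre integrals
`integral_oseenWeightA_line`, `integral_sq_mul_oseenWeightB_line` (values in closed Gaussian form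
`∫_σ^∞ (4πs)^{−d/2} e^{−‖z'‖²/4s} √(4πs)/(4s²) ds`) and the moment identity
`integral_oseenWeightA_sub_sq_mul_oseenWeightB_line`; the fibres of `sideSplit` are such lines
(`sideSplit_symm_eq_sideEmbed_add_smul`, `SideSplitting`). This file reuses its one-dimensional
moment `integral_sq_mul_exp_neg_mul_sq` and its radial lemmas `heatKernel_eq_of_norm_eq`,
`oseenWeightA/B_eq_of_norm_eq`, and adds what the two-slot kernel identity of
`OseenKernelSideFibre` consumes and that file does not state: the fibre integrals of all four of
`G`, `A`, `B`, `r²B` along the fibres of `sideSplit`, with their values identified as the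
**two-dimensional** kernel and weights `G²_s(w)`, `A²(τ, w)`, `B²(τ, w)`, `A²(τ, w)` on
`ℝ² = EuclideanSpace ℝ (Fin 2)` (rather than as closed Gaussian expressions), obtained from one
generic moment-Fubini lemma `integrable_and_integral_moment_fiber` (any weight `m(r) G¹_s(r)`, any
`c sⁿ`); in particular `∫ B³ dr = B²` (`integrable_oseenWeightB_fiber`) is not a consequence of
the moment identity of that file.

## References

* H. Koch, D. Tataru, *Well-posedness for the Navier–Stokes equations*, Adv. Math. 157 (2001),
  §2 (6)–(8) (the Gaussian form of the kernel of `e^{τΔ}Π∇·`), §3 (14) (its decay).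
  [KochTataruAdvMath2001]
* G. Koch, N. Nadirashvili, G. Seregin, V. Šverák, *Liouville theorems for the Navier–Stokes
  equations and applications*, Acta Math. 203 (2009) 83–105 = arXiv:0709.3599: proof of
  Theorem 6.2, p. 13 ("since the solutions `v⁽ᵏ⁾` are axi-symmetric and `M_k ↗ ∞`, it is easy to see
  that `w` is independent of the `x₂`-variable. Applying Theorem 5.1 and Remark 6.1 to the field
  `(w₁, w₃)`, we conclude that `(w₁, w₃)` must vanish identically, and this easily implies that
  `w = 0`"); §3, p. 6 (the kernel `K_{ijk}` of the representation formula (3.3)); §4, p. 8 (the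
  bilinear form `B`). [KochNadirashviliSereginSverak2009]
-/

noncomputable section

open MeasureTheory Set Function Filter WithLp Real
open scoped RealInnerProductSpace ENNReal NNReal

namespace Literature.Analysis.FluidPDE

/-- The axial unit vector has norm one (`norm_single_one_one` of `OseenKernelLineIntegrals`; the
nit of the review of `SideSplitting`). [folklore] -/
theorem norm_sideAxis : ‖sideAxis‖ = 1 := norm_single_one_one

section Gauss1D

/-- The heat kernel of the real line: `G¹_s(r) = (4πs)^{-1/2} e^{-r²/(4s)}`. [folklore] -/
theorem heatKernel_real_apply (s r : ℝ) :
    UnboundedOperators.heatKernel (E := ℝ) s r =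
      (4 * π * s) ^ (-(1:ℝ) / 2) * Real.exp (-(1 / (4 * s)) * r ^ 2) := by
  rw [UnboundedOperators.heatKernel_eq]
  simp [Module.finrank_self, Real.norm_eq_abs, sq_abs]

/-- The heat kernel of the line has mass one (`0 < s`). [folklore] -/
theorem integral_heatKernel_real {s : ℝ} (hs : 0 < s) :
    ∫ r, UnboundedOperators.heatKernel (E := ℝ) s r = 1 :=
  UnboundedOperators.integral_heatKernel_eq_one_holds hs

/-- The heat kernel of the line is integrable (`0 < s`). [folklore] -/
theorem integrable_heatKernel_real {s : ℝ} (hs : 0 < s) :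
    Integrable (UnboundedOperators.heatKernel (E := ℝ) s) :=
  UnboundedOperators.integrable_heatKernel_holds hs

/-- The second moment of the heat kernel of the line converges absolutely (`0 < s`). [folklore] -/
theorem integrable_sq_mul_heatKernel_real {s : ℝ} (hs : 0 < s) :
    Integrable (fun r => r ^ 2 * UnboundedOperators.heatKernel (E := ℝ) s r) := by
  have hb : 0 < 1 / (4 * s) := by positivity
  have h := (integrable_rpow_mul_exp_neg_mul_sq hb (by norm_num : (-1:ℝ) < 2)).const_mul
    ((4 * π * s) ^ (-(1:ℝ) / 2))
  refine h.congr (ae_of_all _ fun r => ?_)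
  simp only [heatKernel_real_apply, Real.rpow_two]
  ring

/-- **Second moment of the heat kernel of the line**: `∫ r² G¹_s(r) dr = 2s` (the variance of the
centred Gaussian of variance `2s`, Mathlib's `variance_fun_id_gaussianReal`). [folklore] -/
theorem integral_sq_mul_heatKernel_real {s : ℝ} (hs : 0 < s) :
    ∫ r, r ^ 2 * UnboundedOperators.heatKernel (E := ℝ) s r = 2 * s := by
  have hb : 0 < 1 / (4 * s) := by positivity
  have hc : 0 < 4 * π * s := by positivity
  have h : ∀ r : ℝ, r ^ 2 * UnboundedOperators.heatKernel (E := ℝ) s r =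
      (4 * π * s) ^ (-(1:ℝ) / 2) * (r ^ 2 * Real.exp (-(1 / (4 * s)) * r ^ 2)) := fun r => by
    rw [heatKernel_real_apply]; ring
  simp_rw [h, integral_const_mul, integral_sq_mul_exp_neg_mul_sq hb]
  have h4 : π / (1 / (4 * s)) = 4 * π * s := by field_simp
  rw [h4, Real.sqrt_eq_rpow]
  have hneg : (4 * π * s) ^ (-(1:ℝ) / 2) * (4 * π * s) ^ (1 / 2 : ℝ) = 1 := by
    rw [← Real.rpow_add hc]
    norm_num
  calc (4 * π * s) ^ (-(1:ℝ) / 2) * ((4 * π * s) ^ (1 / 2 : ℝ) / (2 * (1 / (4 * s))))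
      = (4 * π * s) ^ (-(1:ℝ) / 2) * (4 * π * s) ^ (1 / 2 : ℝ) / (2 * (1 / (4 * s))) := by ring
    _ = 2 * s := by rw [hneg]; field_simp; norm_num

end Gauss1D

/-! ### Factorisation of the heat kernel along the splitting -/

/-- **Factorisation of the Gauss–Weierstrass kernel along the splitting**: `G³_s(w₀, r, w₁) = G²_s(w)
G¹_s(r)` for `0 < s` (`(4πs)^{-3/2} = (4πs)^{-1}(4πs)^{-1/2}` and `‖(r, w)‖² = r² + ‖w‖²`).
[folklore] -/
theorem heatKernel_sideSplit_symm {s : ℝ} (hs : 0 < s) (r : ℝ) (w : (EuclideanSpace ℝ (Fin 2))) :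
    UnboundedOperators.heatKernel s (sideSplit.symm (r, w)) =
      UnboundedOperators.heatKernel s w * UnboundedOperators.heatKernel (E := ℝ) s r := by
  simp only [UnboundedOperators.heatKernel_eq, finrank_euclideanSpace, Fintype.card_fin,
    Module.finrank_self, norm_sq_sideSplit_symm, Real.norm_eq_abs, sq_abs]
  have hc : 0 < 4 * π * s := by positivity
  have hexp : (-((3:ℕ) : ℝ) / 2) = (-((2:ℕ) : ℝ) / 2) + (-((1:ℕ) : ℝ) / 2) := by norm_num
  rw [hexp, Real.rpow_add hc]
  have hexp2 : Real.exp (-(1 / (4 * s)) * (r ^ 2 + ‖w‖ ^ 2)) =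
      Real.exp (-(1 / (4 * s)) * ‖w‖ ^ 2) * Real.exp (-(1 / (4 * s)) * r ^ 2) := by
    rw [← Real.exp_add]; congr 1; ring
  rw [hexp2]
  ring

/-- `∫ G³_s(r, z') dr = G²_s(z')`. [folklore] -/
theorem integral_heatKernel_sideSplit_symm {s : ℝ} (hs : 0 < s) (w : (EuclideanSpace ℝ (Fin 2))) :
    ∫ r, UnboundedOperators.heatKernel s (sideSplit.symm (r, w)) = UnboundedOperators.heatKernel s w := by
  simp_rw [heatKernel_sideSplit_symm hs]
  rw [integral_const_mul, integral_heatKernel_real hs, mul_one]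

/-- The fibres of the three-dimensional heat kernel are integrable (`0 < s`). [folklore] -/
theorem integrable_heatKernel_sideSplit_symm {s : ℝ} (hs : 0 < s) (w : (EuclideanSpace ℝ (Fin 2))) :
    Integrable (fun r => UnboundedOperators.heatKernel s (sideSplit.symm (r, w))) := by
  simp_rw [heatKernel_sideSplit_symm hs]
  exact (integrable_heatKernel_real hs).const_mul _

/-! ### Fubini for half-line Gaussian moments along a vertical fibre -/

/-- Joint measurability of the fibre integrand. [folklore] -/
theorem measurable_fiberIntegrand (z' : (EuclideanSpace ℝ (Fin 2))) (c : ℝ) (n : ℕ) {m : ℝ → ℝ} (hm : Measurable m) :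
    Measurable (fun p : ℝ × ℝ => UnboundedOperators.heatKernel p.1 z' / (c * p.1 ^ n) *
      (m p.2 * UnboundedOperators.heatKernel (E := ℝ) p.1 p.2)) := by
  have h1 : Measurable (fun p : ℝ × ℝ => UnboundedOperators.heatKernel p.1 z') := by
    unfold UnboundedOperators.heatKernel; fun_prop
  have h2 : Measurable (fun p : ℝ × ℝ => UnboundedOperators.heatKernel (E := ℝ) p.1 p.2) := by
    unfold UnboundedOperators.heatKernel; fun_prop
  have h3 : Measurable (fun p : ℝ × ℝ => c * p.1 ^ n) :=
    measurable_const.mul (measurable_fst.pow_const n)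
  have h4 : Measurable (fun p : ℝ × ℝ => m p.2) := hm.comp measurable_snd
  exact (h1.div h3).mul (h4.mul h2)

/-- Integrability of the fibre integrand on `(τ, ∞) × ℝ`. [folklore] -/
theorem integrable_fiberIntegrand {τ : ℝ} (hτ : 0 < τ) (z' : (EuclideanSpace ℝ (Fin 2))) {c : ℝ} (n : ℕ)
    {m : ℝ → ℝ} (hm : Measurable m) (hm0 : ∀ r, 0 ≤ m r) {Mo : ℝ → ℝ}
    (hmi : ∀ s, 0 < s → Integrable (fun r => m r * UnboundedOperators.heatKernel (E := ℝ) s r))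
    (hmv : ∀ s, 0 < s → ∫ r, m r * UnboundedOperators.heatKernel (E := ℝ) s r = Mo s)
    (hc : 0 < c)
    (hI : IntegrableOn (fun s => UnboundedOperators.heatKernel s z' / (c * s ^ n) * Mo s) (Ioi τ)) :
    Integrable (fun p : ℝ × ℝ => UnboundedOperators.heatKernel p.1 z' / (c * p.1 ^ n) *
      (m p.2 * UnboundedOperators.heatKernel (E := ℝ) p.1 p.2))
      ((volume.restrict (Ioi τ)).prod volume) := by
  rw [integrable_prod_iff (measurable_fiberIntegrand z' c n hm).aestronglyMeasurable]
  constructor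
  · refine (ae_restrict_iff' measurableSet_Ioi).2 (ae_of_all _ fun s (hs : τ < s) => ?_)
    show Integrable (fun y => UnboundedOperators.heatKernel s z' / (c * s ^ n) *
      (m y * UnboundedOperators.heatKernel (E := ℝ) s y)) volume
    exact (hmi s (hτ.trans hs)).const_mul _
  · refine hI.congr_fun (fun s (hs : τ < s) => ?_) measurableSet_Ioi
    have hs0 : 0 < s := hτ.trans hs
    dsimp only
    rw [← hmv s hs0, ← integral_const_mul]
    refine integral_congr_ae (ae_of_all _ fun r => ?_)
    dsimp only
    rw [Real.norm_of_nonneg]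
    have h1 := (UnboundedOperators.heatKernel_pos hs0 z').le
    have h2 := (UnboundedOperators.heatKernel_pos (E := ℝ) hs0 r).le
    have h3 : 0 ≤ c * s ^ n := by positivity
    exact mul_nonneg (div_nonneg h1 h3) (mul_nonneg (hm0 r) h2)

/-- Fubini for a half-line Gaussian moment along a vertical fibre. [folklore] -/
theorem integrable_and_integral_moment_fiber {τ : ℝ} (hτ : 0 < τ) (z' : (EuclideanSpace ℝ (Fin 2))) {c : ℝ} (n : ℕ)
    {m : ℝ → ℝ} (hm : Measurable m) (hm0 : ∀ r, 0 ≤ m r) {Mo : ℝ → ℝ}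
    (hmi : ∀ s, 0 < s → Integrable (fun r => m r * UnboundedOperators.heatKernel (E := ℝ) s r))
    (hmv : ∀ s, 0 < s → ∫ r, m r * UnboundedOperators.heatKernel (E := ℝ) s r = Mo s)
    (hc : 0 < c)
    (hI : IntegrableOn (fun s => UnboundedOperators.heatKernel s z' / (c * s ^ n) * Mo s) (Ioi τ)) :
    Integrable (fun r => m r *
        ∫ s in Ioi τ, UnboundedOperators.heatKernel s (sideSplit.symm (r, z')) / (c * s ^ n)) ∧
      ∫ r, m r * ∫ s in Ioi τ, UnboundedOperators.heatKernel s (sideSplit.symm (r, z')) / (c * s ^ n) =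
        ∫ s in Ioi τ, UnboundedOperators.heatKernel s z' / (c * s ^ n) * Mo s := by
  have hF := integrable_fiberIntegrand hτ z' n hm hm0 hmi hmv hc hI
  -- the fibre integrand rewritten
  have hF_eq : ∀ s, 0 < s → ∀ r, UnboundedOperators.heatKernel s z' / (c * s ^ n) *
      (m r * UnboundedOperators.heatKernel (E := ℝ) s r) =
      m r * (UnboundedOperators.heatKernel s (sideSplit.symm (r, z')) / (c * s ^ n)) := by
    intro s hs r
    rw [heatKernel_sideSplit_symm hs]
    ring
  have hcol : ∀ r, ∫ s in Ioi τ, UnboundedOperators.heatKernel s z' / (c * s ^ n) *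
      (m r * UnboundedOperators.heatKernel (E := ℝ) s r) =
      m r * ∫ s in Ioi τ, UnboundedOperators.heatKernel s (sideSplit.symm (r, z')) / (c * s ^ n) := by
    intro r
    rw [← integral_const_mul]
    exact setIntegral_congr_fun measurableSet_Ioi fun s (hs : τ < s) => hF_eq s (hτ.trans hs) r
  have hrow : ∀ s, 0 < s → ∫ r, UnboundedOperators.heatKernel s z' / (c * s ^ n) *
      (m r * UnboundedOperators.heatKernel (E := ℝ) s r) =
      UnboundedOperators.heatKernel s z' / (c * s ^ n) * Mo s := by
    intro s hs
    rw [integral_const_mul, hmv s hs]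
  refine ⟨?_, ?_⟩
  · have h := hF.integral_prod_right
    refine h.congr (ae_of_all _ fun r => ?_)
    exact hcol r
  · have h1 := integral_prod _ hF
    have h2 := integral_prod_symm _ hF
    rw [h1] at h2
    -- h2 : ∫ s, ∫ r, F (s, r) = ∫ r, ∫ s, F (s, r)
    have h3 : ∫ s in Ioi τ, ∫ r, UnboundedOperators.heatKernel s z' / (c * s ^ n) *
        (m r * UnboundedOperators.heatKernel (E := ℝ) s r) =
        ∫ s in Ioi τ, UnboundedOperators.heatKernel s z' / (c * s ^ n) * Mo s :=
      setIntegral_congr_fun measurableSet_Ioi fun s (hs : τ < s) => hrow s (hτ.trans hs)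
    have h4 : ∫ r, ∫ s in Ioi τ, UnboundedOperators.heatKernel s z' / (c * s ^ n) *
        (m r * UnboundedOperators.heatKernel (E := ℝ) s r) =
        ∫ r, m r * ∫ s in Ioi τ,
          UnboundedOperators.heatKernel s (sideSplit.symm (r, z')) / (c * s ^ n) :=
      integral_congr_ae (ae_of_all _ fun r => hcol r)
    rw [← h4, ← h2, h3]


/-! ### The Gaussian weights along a vertical fibre -/

section Weights

/-- Reflection in the vertical coordinate preserves the norm: `‖sideSplit.symm (−r, w)‖ =
‖sideSplit.symm (r, w)‖`. [folklore] -/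
theorem norm_sideSplit_symm_neg (r : ℝ) (w : (EuclideanSpace ℝ (Fin 2))) :
    ‖sideSplit.symm (-r, w)‖ = ‖sideSplit.symm (r, w)‖ := by
  have h1 := norm_sq_sideSplit_symm (-r) w
  rw [neg_sq, ← norm_sq_sideSplit_symm r w] at h1
  exact (pow_left_inj₀ (norm_nonneg _) (norm_nonneg _) two_ne_zero).1 h1

/-- **Fibre integral of the first Gaussian weight**: `r ↦ A³(τ, (w₀, r, w₁))` is integrable and `∫
A³(τ, (w₀, r, w₁)) dr = A²(τ, w)` for `0 < τ` (Tonelli on `A(τ, z) = ∫_τ^∞ G_s(z)/(4s²) ds`,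
Koch–Tataru 2001, §2 (6)–(8), and `∫ G¹_s = 1`). [cite: KochTataruAdvMath2001, §2 (6)–(8)] -/
theorem integrable_oseenWeightA_fiber {τ : ℝ} (hτ : 0 < τ) (z' : (EuclideanSpace ℝ (Fin 2))) :
    Integrable (fun r => oseenWeightA τ (sideSplit.symm (r, z'))) ∧
      ∫ r, oseenWeightA τ (sideSplit.symm (r, z')) = oseenWeightA τ z' := by
  obtain ⟨C, -, hA⟩ := exists_oseenWeightA_le (E := (EuclideanSpace ℝ (Fin 2)))
  obtain ⟨hI, -, -⟩ := hA hτ z'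
  have h := integrable_and_integral_moment_fiber hτ z' 2 (m := fun _ => (1:ℝ)) measurable_const
    (fun _ => zero_le_one) (Mo := fun _ => (1:ℝ))
    (fun s hs => by simpa using integrable_heatKernel_real hs)
    (fun s hs => by simp [integral_heatKernel_real hs]) (by norm_num : (0:ℝ) < 4)
    (by simpa using hI)
  simpa only [oseenWeightA, one_mul, mul_one] using h

/-- **Fibre integral of the second Gaussian weight**: `r ↦ B³(τ, (w₀, r, w₁))` is integrable and `∫
B³(τ, (w₀, r, w₁)) dr = B²(τ, w)` for `0 < τ` (Koch–Tataru 2001, §2 (6)–(8)). [cite: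
KochTataruAdvMath2001, §2 (6)–(8)] -/
theorem integrable_oseenWeightB_fiber {τ : ℝ} (hτ : 0 < τ) (z' : (EuclideanSpace ℝ (Fin 2))) :
    Integrable (fun r => oseenWeightB τ (sideSplit.symm (r, z'))) ∧
      ∫ r, oseenWeightB τ (sideSplit.symm (r, z')) = oseenWeightB τ z' := by
  obtain ⟨C, -, hB⟩ := exists_oseenWeightB_le (E := (EuclideanSpace ℝ (Fin 2)))
  obtain ⟨hI, -, -⟩ := hB hτ z'
  have h := integrable_and_integral_moment_fiber hτ z' 3 (m := fun _ => (1:ℝ)) measurable_const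
    (fun _ => zero_le_one) (Mo := fun _ => (1:ℝ))
    (fun s hs => by simpa using integrable_heatKernel_real hs)
    (fun s hs => by simp [integral_heatKernel_real hs]) (by norm_num : (0:ℝ) < 8)
    (by simpa using hI)
  simpa only [oseenWeightB, one_mul, mul_one] using h

/-- **The Gaussian moment identity** `∫ r² B³(τ, (z', r)) dr = A²(τ, z')`. [cite: KochTataruAdvMath2001, §2 (6)–(8)] -/
theorem integrable_sq_mul_oseenWeightB_fiber {τ : ℝ} (hτ : 0 < τ) (z' : (EuclideanSpace ℝ (Fin 2))) :
    Integrable (fun r => r ^ 2 * oseenWeightB τ (sideSplit.symm (r, z'))) ∧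
      ∫ r, r ^ 2 * oseenWeightB τ (sideSplit.symm (r, z')) = oseenWeightA τ z' := by
  obtain ⟨C, -, hA⟩ := exists_oseenWeightA_le (E := (EuclideanSpace ℝ (Fin 2)))
  obtain ⟨hI, -, -⟩ := hA hτ z'
  have hqs : ∀ s ∈ Ioi τ, UnboundedOperators.heatKernel s z' / (4 * s ^ 2) =
      UnboundedOperators.heatKernel s z' / (8 * s ^ 3) * (2 * s) := by
    intro s (hs : τ < s)
    have : s ≠ 0 := (hτ.trans hs).ne'
    field_simp
    ring
  have hI' : IntegrableOn (fun s => UnboundedOperators.heatKernel s z' / (8 * s ^ 3) * (2 * s))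
      (Ioi τ) := hI.congr_fun hqs measurableSet_Ioi
  have h := integrable_and_integral_moment_fiber hτ z' 3 (m := fun r => r ^ 2)
    (measurable_id.pow_const 2) (fun r => sq_nonneg r) (Mo := fun s => 2 * s)
    (fun s hs => integrable_sq_mul_heatKernel_real hs)
    (fun s hs => integral_sq_mul_heatKernel_real hs) (by norm_num : (0:ℝ) < 8) hI'
  refine ⟨h.1, h.2.trans ?_⟩
  rw [oseenWeightA]
  exact (setIntegral_congr_fun measurableSet_Ioi hqs).symm

end Weights

end Literature.Analysis.FluidPDE

end
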